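import Summits.AtomisticToContinuum.HydrodynamicLimit.Theorems.AntiMazurCoboundariesKineticWindowGronwallRareBandDock
import HarnessLib

/-!
# End state of line `rare-band-ladder-dock` ON THE BOARD (crux `KineticWindowGronwall`, stmt-AtomisticToContinuum-9282)

Lead c4's closing record (helper file, `--supports` the crux; registered helper stub `stub_cruxOfBoardInputs`). With the rare band DOCKED
(`KineticWindowGronwallRareBandDock.quadraticClassLdDecay_of_equilibriumFastWindowLD`: TwoClocks crux stmt-14440 `EquilibriumFastWindowLD` ⟹
the line's quadratic class, p141908) the crux is reduced, kernel-checked, to BOARD INPUTS plus ONE shared kinetic wall, here typed in its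
DOCKABLE form:

* `LocalTransferE := EquilibriumFastWindowLD → LocalQuadraticWindowLDFamily` — the local transfer FROM THE BOARD CRUX 14440. It is WEAKER than
  the registered `KineticWindowGronwallEndState.LocalTransferQ` (`:= QuadraticClassLdDecay → LocalQuadraticWindowLDFamily`;
  `localTransferE_of_localTransferQ`, the dock supplying `QuadraticClassLdDecay` from 14440), carries the SAME open content ((i) one-window
  pressure-level locality under the x-dependent hard-core local Gibbs law, (ii) density-band uniformity, (iii) uniformity along the
  compact reference family and the window upgrade under a NON-invariant reference), and is exactly what a closed TwoClocks 14443
  (`LocalGibbsTransfer := EquilibriumFastWindowLD → KineticWindowLDUniform`) plus (iii)-glue would deliver — whereas `LocalTransferQ` would in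
  addition require the non-formal converse `QuadraticClassLdDecay → EquilibriumFastWindowLD` (product class ⇒ general `F(x,v)`).

Main theorem `kineticWindowGronwall_of_board : EquilibriumFastWindowLD → LocalTransferE → SharedInputs → KineticWindowGronwall` (the landed
product kinetic instance `stub_productKineticInstance` and clock `stub_clockFromInstance` of lead c3; `SharedInputs` = LCTF ∧ CSCV-W ∧ 16624 ∧
9235 ∧ 3091 by name). HONESTY: in this composition the crux's antecedent `A = KineticFluxLdDecay` is idle — necessarily so, since
`A ⇐ EquilibriumFastWindowLD` (landed `KineticWindowGronwallRareBandDock.kineticFluxLdDecay_of_equilibriumFastWindowLD`, not restated here); A is load-bearing only relative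
to the strictly weaker pair `(A, RareBandLdDecay)` of the landed ladder (`KineticWindowGronwallEndState.quadraticClass_iff`). The planners'
dependency cone of stmt-9282 after lead c4: {14440, `LocalTransferE`, LCTF, CSCV-W, 16624, 9235, 3091}.
-/

noncomputable section

namespace Summit.AtomisticToContinuum.HydrodynamicLimit.Theorems.KineticWindowGronwallEndStateBoard

open Summit.AtomisticToContinuum.HydrodynamicLimit.Theses.AntiMazurCoboundaries (KineticFluxLdDecay KineticWindowGronwall)
open Summit.AtomisticToContinuum.HydrodynamicLimit.Theses.TwoClocks (EquilibriumFastWindowLD)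
open Summit.AtomisticToContinuum.HydrodynamicLimit.Theorems.KineticWindowGronwallEndState (LocalQuadraticWindowLDFamily LocalTransferQ
  SharedInputs)
open Summit.AtomisticToContinuum.HydrodynamicLimit.Theorems.KineticWindowGronwallRareBandDock (quadraticClassLdDecay_of_equilibriumFastWindowLD)

/-! ## §1 Statements -/

/-- **THE LOCAL TRANSFER FROM THE BOARD CRUX** (dockable form of the line's shared kinetic wall): `EquilibriumFastWindowLD (stmt-14440) →
LocalQuadraticWindowLDFamily`. Open (crux-sized; twin of TwoClocks 14443 / 16625-S3b for product observables along reference families). -/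
def LocalTransferE : Prop :=
  EquilibriumFastWindowLD → LocalQuadraticWindowLDFamily

/-- **THE CRUX FROM BOARD INPUTS** (signature of the registered helper stub `stub_cruxOfBoardInputs`):
`EquilibriumFastWindowLD → LocalTransferE → SharedInputs → KineticWindowGronwall`. -/
def CruxOfBoardInputs : Prop :=
  EquilibriumFastWindowLD → LocalTransferE → SharedInputs → KineticWindowGronwall

/-! ## §2 The end state on the board -/

/-- The registered transfer implies the board transfer (the dock supplies the quadratic class from 14440). [folklore] -/
theorem localTransferE_of_localTransferQ (h₄ : LocalTransferQ) : LocalTransferE :=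
  fun h₀ => h₄ (quadraticClassLdDecay_of_equilibriumFastWindowLD h₀)

/-- **THE CRUX FROM BOARD INPUTS.** `EquilibriumFastWindowLD → LocalTransferE → SharedInputs → KineticWindowGronwall`: the transfer localises the
board crux along the Euler reference family, the LANDED product kinetic instance (`stub_productKineticInstance`) feeds the LANDED clock
(`stub_clockFromInstance`), which reaches `RelEntropyVanishing` verbatim with the shared inputs; the antecedent is not used (see the module
docstring: it is implied by the first hypothesis). [cite: OllaVaradhanYau1993, §2–3] -/
theorem kineticWindowGronwall_of_board (h₀ : EquilibriumFastWindowLD) (h₄ : LocalTransferE) (h₇ : SharedInputs) : KineticWindowGronwall :=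
  fun _ =>
    KineticWindowGronwallClockFromInstance.stub_clockFromInstance
      (KineticWindowGronwallProductKineticInstance.stub_productKineticInstance (h₄ h₀))
      h₇.1 h₇.2.1 h₇.2.2.1 h₇.2.2.2.1 h₇.2.2.2.2

/-- **Registered helper stub `stub_cruxOfBoardInputs`**: the end state of line `rare-band-ladder-dock` on the board. [folklore] -/
theorem stub_cruxOfBoardInputs : CruxOfBoardInputs :=
  kineticWindowGronwall_of_board

/-- The same for the item's primary decl (route FluxGibbsianityLdDrude shares stmt-9282 verbatim; same term). [folklore] -/
theorem kineticWindowGronwall_of_board' (h₀ : EquilibriumFastWindowLD) (h₄ : LocalTransferE) (h₇ : SharedInputs) :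
    Summit.AtomisticToContinuum.HydrodynamicLimit.Theses.FluxGibbsianityLdDrude.KineticWindowGronwall :=
  kineticWindowGronwall_of_board h₀ h₄ h₇

end Summit.AtomisticToContinuum.HydrodynamicLimit.Theorems.KineticWindowGronwallEndStateBoard

end
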